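import Mathlib
import HarnessLib
import Summits.AtomisticToContinuum.Crystallization.Theorems.PricedLinkCensusSoftFourRingsWings

/-!
# Soft four-rings, endgame: the cells of a type-A vertex end at the wings of its `γ`-partner

Support file for `SoftFourRings` (route `PricedLinkCensus`, sub-problem `Crystallization`),
endgame step (E3) of the evidence file (§12.8), point-level form.  For type-A data
`(a, b, c, d)` at `v` and type-A data `(a₃, b₃, c₃, v)` at the `γ`-partner `d`
(`typeA_gamma`):

* `typeA_swap` — the data `(c, b, a, d)` is again type-A data at `v`;
* `wing_not_common` — a type-O vertex with a bonded pair `{d, m}` is not bonded to both of two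
  non-bonded points `a ≠ c` outside `{d, m}`;
* `cells_end_at_wings` — **`a ∼ a₃` and `c ∼ c₃`, or `a ∼ c₃` and `c ∼ a₃`**: the two cells
  at `v` through the `γ`-bond `{v, d}` close up at the two wings of the `α`-bond of `d`;
* `typeO_typeA_false` — no vertex carries both type-O and type-A data;
* `common_of_alpha` — a common bond of `v` and its `α`-partner `b` is a wing `a` or `c`.
-/

namespace Summit.AtomisticToContinuum.Crystallization.Theorems

open Real RealInnerProductSpace Literature.Geometry.DiscreteGeometry

section Pairs

variable {B : Finset (Finset (EuclideanSpace ℝ (Fin 3)))}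

/-- **Type-A data is symmetric in the two wings.** -/
theorem typeA_swap {v a b c d : EuclideanSpace ℝ (Fin 3)}
    (hN : ∀ y, ({v, y} : Finset (EuclideanSpace ℝ (Fin 3))) ∈ B ↔ (y = a ∨ y = b ∨ y = c ∨ y = d))
    (hd : a ≠ b ∧ a ≠ c ∧ a ≠ d ∧ b ≠ c ∧ b ≠ d ∧ c ≠ d)
    (hab : ({a, b} : Finset (EuclideanSpace ℝ (Fin 3))) ∈ B)
    (hbc : ({b, c} : Finset (EuclideanSpace ℝ (Fin 3))) ∈ B)
    (hac : ({a, c} : Finset (EuclideanSpace ℝ (Fin 3))) ∉ B)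
    (had : ({a, d} : Finset (EuclideanSpace ℝ (Fin 3))) ∉ B)
    (hbd : ({b, d} : Finset (EuclideanSpace ℝ (Fin 3))) ∉ B)
    (hcd : ({c, d} : Finset (EuclideanSpace ℝ (Fin 3))) ∉ B) :
    (∀ y, ({v, y} : Finset (EuclideanSpace ℝ (Fin 3))) ∈ B ↔ (y = c ∨ y = b ∨ y = a ∨ y = d)) ∧
    (c ≠ b ∧ c ≠ a ∧ c ≠ d ∧ b ≠ a ∧ b ≠ d ∧ a ≠ d) ∧
    ({c, b} : Finset (EuclideanSpace ℝ (Fin 3))) ∈ B ∧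
    ({b, a} : Finset (EuclideanSpace ℝ (Fin 3))) ∈ B ∧
    ({c, a} : Finset (EuclideanSpace ℝ (Fin 3))) ∉ B ∧
    ({c, d} : Finset (EuclideanSpace ℝ (Fin 3))) ∉ B ∧
    ({b, d} : Finset (EuclideanSpace ℝ (Fin 3))) ∉ B ∧
    ({a, d} : Finset (EuclideanSpace ℝ (Fin 3))) ∉ B := by
  refine ⟨fun y => (hN y).trans (by tauto), ⟨hd.2.2.2.1.symm, hd.2.1.symm, hd.2.2.2.2.2,
    hd.1.symm, hd.2.2.2.2.1, hd.2.2.1⟩, by rw [Finset.pair_comm]; exact hbc,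
    by rw [Finset.pair_comm]; exact hab, by rw [Finset.pair_comm]; exact hac, hcd, hbd, had⟩

/-- **A type-O vertex `w` with bonded pair `{d, m}` is not a common bond of two non-bonded
points outside `{d, m}`.** -/
theorem wing_not_common {w d m p q a c : EuclideanSpace ℝ (Fin 3)}
    (hNw : ∀ y, ({w, y} : Finset (EuclideanSpace ℝ (Fin 3))) ∈ B ↔ (y = d ∨ y = m ∨ y = p ∨ y = q))
    (hpq : ({p, q} : Finset (EuclideanSpace ℝ (Fin 3))) ∈ B)
    (hac : ({a, c} : Finset (EuclideanSpace ℝ (Fin 3))) ∉ B) (hac' : a ≠ c)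
    (had : a ≠ d) (ham : a ≠ m) (hcd : c ≠ d) (hcm : c ≠ m)
    (hwa : ({w, a} : Finset (EuclideanSpace ℝ (Fin 3))) ∈ B)
    (hwc : ({w, c} : Finset (EuclideanSpace ℝ (Fin 3))) ∈ B) : False := by
  have ha : a = p ∨ a = q := by
    rcases (hNw a).1 hwa with h | h | h | h
    exacts [absurd h had, absurd h ham, Or.inl h, Or.inr h]
  have hc : c = p ∨ c = q := by
    rcases (hNw c).1 hwc with h | h | h | h
    exacts [absurd h hcd, absurd h hcm, Or.inl h, Or.inr h]
  rcases ha with rfl | rfl <;> rcases hc with rfl | rfl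
  · exact hac' rfl
  · exact hac hpq
  · exact hac (by rw [Finset.pair_comm]; exact hpq)
  · exact hac' rfl

end Pairs

section Setting

variable {X : Finset (EuclideanSpace ℝ (Fin 3))} {B : Finset (Finset (EuclideanSpace ℝ (Fin 3)))}
  (hT : musinTarasov2012_tammes_thirteen) (hX1 : ∀ y ∈ X, ‖y‖ = 1) (hcard : X.card = 12)
  (hsepX : ∀ u ∈ X, ∀ u' ∈ X, u ≠ u' → ⟪u, u'⟫ ≤ 1 - 1 / (2 * (101 / 100 : ℝ) ^ 2))
  (hB : ∀ T ∈ B, ∃ u ∈ X, ∃ u' ∈ X, u ≠ u' ∧ 1 - (101 / 100 : ℝ) ^ 2 / 2 ≤ ⟪u, u'⟫ ∧ T = {u, u'})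
  (hBcard : B.card = 24)
  (hdeg : ∀ v ∈ X, ∃ w : Fin 4 → EuclideanSpace ℝ (Fin 3), (∀ k, w k ∈ X) ∧
    Function.Injective w ∧ (∀ k, w k ≠ v) ∧
    (∀ k, ({v, w k} : Finset (EuclideanSpace ℝ (Fin 3))) ∈ B) ∧
    ∀ y, ({v, y} : Finset (EuclideanSpace ℝ (Fin 3))) ∈ B → ∃ k, y = w k)

include hT hX1 hcard hsepX hB hBcard hdeg in
open scoped Classical in
/-- **The cells at a type-A vertex close up at the wings of the `γ`-partner's `α`-bond.** -/
theorem cells_end_at_wings {v a b c d a₃ b₃ c₃ : EuclideanSpace ℝ (Fin 3)} (hv : v ∈ X)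
    (hN : ∀ y, ({v, y} : Finset (EuclideanSpace ℝ (Fin 3))) ∈ B ↔ (y = a ∨ y = b ∨ y = c ∨ y = d))
    (hd : a ≠ b ∧ a ≠ c ∧ a ≠ d ∧ b ≠ c ∧ b ≠ d ∧ c ≠ d)
    (hab : ({a, b} : Finset (EuclideanSpace ℝ (Fin 3))) ∈ B)
    (hbc : ({b, c} : Finset (EuclideanSpace ℝ (Fin 3))) ∈ B)
    (hac : ({a, c} : Finset (EuclideanSpace ℝ (Fin 3))) ∉ B)
    (had : ({a, d} : Finset (EuclideanSpace ℝ (Fin 3))) ∉ B)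
    (hbd : ({b, d} : Finset (EuclideanSpace ℝ (Fin 3))) ∉ B)
    (hcd : ({c, d} : Finset (EuclideanSpace ℝ (Fin 3))) ∉ B)
    (hN₃ : ∀ y, ({d, y} : Finset (EuclideanSpace ℝ (Fin 3))) ∈ B ↔
      (y = a₃ ∨ y = b₃ ∨ y = c₃ ∨ y = v))
    (hd₃ : a₃ ≠ b₃ ∧ a₃ ≠ c₃ ∧ a₃ ≠ v ∧ b₃ ≠ c₃ ∧ b₃ ≠ v ∧ c₃ ≠ v)
    (hab₃ : ({a₃, b₃} : Finset (EuclideanSpace ℝ (Fin 3))) ∈ B)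
    (hbc₃ : ({b₃, c₃} : Finset (EuclideanSpace ℝ (Fin 3))) ∈ B)
    (hac₃ : ({a₃, c₃} : Finset (EuclideanSpace ℝ (Fin 3))) ∉ B)
    (hav₃ : ({a₃, v} : Finset (EuclideanSpace ℝ (Fin 3))) ∉ B)
    (hbv₃ : ({b₃, v} : Finset (EuclideanSpace ℝ (Fin 3))) ∉ B)
    (hcv₃ : ({c₃, v} : Finset (EuclideanSpace ℝ (Fin 3))) ∉ B) :
    (({a, a₃} : Finset (EuclideanSpace ℝ (Fin 3))) ∈ B ∧
      ({c, c₃} : Finset (EuclideanSpace ℝ (Fin 3))) ∈ B) ∨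
    (({a, c₃} : Finset (EuclideanSpace ℝ (Fin 3))) ∈ B ∧
      ({c, a₃} : Finset (EuclideanSpace ℝ (Fin 3))) ∈ B) := by
  obtain ⟨⟨x₁, -, hx₁v, hx₁a, hx₁b, hx₁c, hx₁d, hx₁B, hx₁Ba, hf₁⟩,
    ⟨x₂, -, hx₂v, hx₂a, hx₂b, hx₂c, hx₂d, hx₂B, hx₂Bc, hf₂⟩⟩ :=
    typeA_cells hT hX1 hcard hsepX hB hBcard hdeg hv hN hd hab hbc hac had hbd hcd
  have h₁ := wing_cell hT hX1 hcard hsepX hB hBcard hN₃ hd₃ hab₃ hbc₃ hx₁v hx₁B hf₁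
  have h₂ := wing_cell hT hX1 hcard hsepX hB hBcard hN₃ hd₃ hab₃ hbc₃ hx₂v hx₂B hf₂
  -- the two cell points are different wings
  have hdb₃ : ({d, b₃} : Finset (EuclideanSpace ℝ (Fin 3))) ∈ B := (hN₃ b₃).2 (Or.inr (Or.inl rfl))
  have had' : a ≠ d := hd.2.2.1
  have hcd' : c ≠ d := hd.2.2.2.2.2
  have hab₃' : a ≠ b₃ := fun h => had (by rw [h, Finset.pair_comm]; exact hdb₃)
  have hcb₃' : c ≠ b₃ := fun h => hcd (by rw [h, Finset.pair_comm]; exact hdb₃)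
  have hne : x₁ ≠ x₂ := by
    intro heq
    rw [← heq] at hx₂Bc
    -- `x₁` is a wing of `{d, b₃}`, of type O with bonded pair `{d, b₃}`
    rcases h₁ with rfl | rfl
    · obtain ⟨p, q, hNw, -, -, hpq, -⟩ :=
        typeA_wing hT hX1 hcard hsepX hB hBcard hdeg hN₃ hd₃ hab₃ hbc₃ hac₃ hav₃ hbv₃
      exact wing_not_common hNw hpq hac hd.2.1 had' hab₃' hcd' hcb₃' hx₁Ba hx₂Bc
    · obtain ⟨hN₃', hd₃', hcb₃, hba₃, hca₃, hcv₃', hbv₃', hav₃'⟩ :=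
        typeA_swap hN₃ hd₃ hab₃ hbc₃ hac₃ hav₃ hbv₃ hcv₃
      obtain ⟨p, q, hNw, -, -, hpq, -⟩ :=
        typeA_wing hT hX1 hcard hsepX hB hBcard hdeg hN₃' hd₃' hcb₃ hba₃ hca₃ hcv₃' hbv₃'
      exact wing_not_common hNw hpq hac hd.2.1 had' hab₃' hcd' hcb₃' hx₁Ba hx₂Bc
  rcases h₁ with rfl | rfl <;> rcases h₂ with rfl | rfl
  · exact absurd rfl hne
  · exact Or.inl ⟨by rw [Finset.pair_comm]; exact hx₁Ba, by rw [Finset.pair_comm]; exact hx₂Bc⟩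
  · exact Or.inr ⟨by rw [Finset.pair_comm]; exact hx₁Ba, by rw [Finset.pair_comm]; exact hx₂Bc⟩
  · exact absurd rfl hne

end Setting

section PairsB

variable {B : Finset (Finset (EuclideanSpace ℝ (Fin 3)))}

/-- **Type O and type A exclude each other.** -/
theorem typeO_typeA_false {u a b c d a' b' c' d' : EuclideanSpace ℝ (Fin 3)}
    (hN : ∀ y, ({u, y} : Finset (EuclideanSpace ℝ (Fin 3))) ∈ B ↔ (y = a ∨ y = b ∨ y = c ∨ y = d))
    (hd : a ≠ b ∧ a ≠ c ∧ a ≠ d ∧ b ≠ c ∧ b ≠ d ∧ c ≠ d)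
    (hac : ({a, c} : Finset (EuclideanSpace ℝ (Fin 3))) ∉ B)
    (had : ({a, d} : Finset (EuclideanSpace ℝ (Fin 3))) ∉ B)
    (hbc : ({b, c} : Finset (EuclideanSpace ℝ (Fin 3))) ∉ B)
    (hbd : ({b, d} : Finset (EuclideanSpace ℝ (Fin 3))) ∉ B)
    (hN' : ∀ y, ({u, y} : Finset (EuclideanSpace ℝ (Fin 3))) ∈ B ↔
      (y = a' ∨ y = b' ∨ y = c' ∨ y = d'))
    (hd' : a' ≠ b' ∧ a' ≠ c' ∧ a' ≠ d' ∧ b' ≠ c' ∧ b' ≠ d' ∧ c' ≠ d')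
    (hab' : ({a', b'} : Finset (EuclideanSpace ℝ (Fin 3))) ∈ B)
    (hbc' : ({b', c'} : Finset (EuclideanSpace ℝ (Fin 3))) ∈ B) : False := by
  have ha' := (hN a').1 ((hN' a').2 (Or.inl rfl))
  have hb' := (hN b').1 ((hN' b').2 (Or.inr (Or.inl rfl)))
  have hc' := (hN c').1 ((hN' c').2 (Or.inr (Or.inr (Or.inl rfl))))
  have h1 := bond_pair_typeO hac had hbc hbd ha' hb' hd'.1 hab'
  have h2 := bond_pair_typeO hac had hbc hbd hb' hc' hd'.2.2.2.1 hbc'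
  have hsame : ({a', b'} : Finset (EuclideanSpace ℝ (Fin 3))) ≠ {b', c'} := by
    intro e
    rcases (mem_or_of_pair_eq e).1 with h | h
    · exact hd'.1 h
    · exact hd'.2.1 h
  have hdisj : ∀ {p q r : EuclideanSpace ℝ (Fin 3)},
      ({p, q} : Finset (EuclideanSpace ℝ (Fin 3))) = {a, b} →
      ({q, r} : Finset (EuclideanSpace ℝ (Fin 3))) = {c, d} → False := by
    intro p q r e1 e2
    rcases (mem_or_of_pair_eq e1).2 with h | h <;> rcases (mem_or_of_pair_eq e2).1 with h' | h'
    · exact hd.2.1 (h.symm.trans h')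
    · exact hd.2.2.1 (h.symm.trans h')
    · exact hd.2.2.2.1 (h.symm.trans h')
    · exact hd.2.2.2.2.1 (h.symm.trans h')
  have hdisj' : ∀ {p q r : EuclideanSpace ℝ (Fin 3)},
      ({p, q} : Finset (EuclideanSpace ℝ (Fin 3))) = {c, d} →
      ({q, r} : Finset (EuclideanSpace ℝ (Fin 3))) = {a, b} → False := by
    intro p q r e1 e2
    rcases (mem_or_of_pair_eq e1).2 with h | h <;> rcases (mem_or_of_pair_eq e2).1 with h' | h'
    · exact hd.2.1 (h'.symm.trans h)
    · exact hd.2.2.2.1 (h'.symm.trans h)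
    · exact hd.2.2.1 (h'.symm.trans h)
    · exact hd.2.2.2.2.1 (h'.symm.trans h)
  rcases h1 with h1 | h1 <;> rcases h2 with h2 | h2
  · exact hsame (h1.trans h2.symm)
  · exact hdisj h1 h2
  · exact hdisj' h1 h2
  · exact hsame (h1.trans h2.symm)

/-- **A common bond of `v` and its `α`-partner `b` is a wing.** -/
theorem common_of_alpha {X : Finset (EuclideanSpace ℝ (Fin 3))}
    (hB : ∀ T ∈ B, ∃ u ∈ X, ∃ u' ∈ X, u ≠ u' ∧ 1 - (101 / 100 : ℝ) ^ 2 / 2 ≤ ⟪u, u'⟫ ∧ T = {u, u'})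
    {v a b c d z : EuclideanSpace ℝ (Fin 3)}
    (hN : ∀ y, ({v, y} : Finset (EuclideanSpace ℝ (Fin 3))) ∈ B ↔ (y = a ∨ y = b ∨ y = c ∨ y = d))
    (hbd : ({b, d} : Finset (EuclideanSpace ℝ (Fin 3))) ∉ B)
    (hzv : ({z, v} : Finset (EuclideanSpace ℝ (Fin 3))) ∈ B)
    (hzb : ({z, b} : Finset (EuclideanSpace ℝ (Fin 3))) ∈ B) : z = a ∨ z = c := by
  have hvz : ({v, z} : Finset (EuclideanSpace ℝ (Fin 3))) ∈ B := by rw [Finset.pair_comm]; exact hzv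
  rcases (hN z).1 hvz with h | h | h | h
  · exact Or.inl h
  · exact absurd h (ne_of_mem_bonds hB hzb)
  · exact Or.inr h
  · exact absurd (h ▸ (by rw [Finset.pair_comm]; exact hzb)) hbd

end PairsB

end Summit.AtomisticToContinuum.Crystallization.Theorems
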